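import Mathlib
import Summits.Ventures.HodgeRepro0.P6NonSimple2Power
/-!
# P6NonSimple2PowerConseq — the consequence of the class-representative certificate, kernel-checked per configuration
(p6 g10; extends `P6NonSimple2Power` (p488161): every primitive balanced set of every listed `C₂ × C₈` configuration of
`(4,4)`, `(4,2,2)`, `(4,2,1,1)`, `(4,1,1,1,1)` has at most two points — NO primitive balanced `2p`-set with `p ≥ 2`)

The two-line argument of `P6NonSimple2Power`'s header is now a theorem (`key`), and `c44_no_primitive` … `c41111_no_primitive`,
`c44_primitive_card_le_two` … apply it to every listed configuration with the decidable hypotheses discharged by `decide`.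
POINTS: `(i, false)` = the representative `x_i ∈ Φ` (the `i`-th entry of `reps`), `(i, true)` = its `ι`-partner; the sign
vector of `(i, false)` is `vrep c i` — computed from the configuration's own data by `sgn` — and that of `(i, true)` is
`−vrep c i` (`sv`), which IS the partner's own sign vector `vpart c i` computed from the data (`c44_partner` …, by `decide`).
BALANCED (Definition 1.1 of P5-LowDimCensus in sign-vector form): `∑_{y ∈ Δ} sgn(y) = 0` as a function on `T`, i.e.
`|tΔ ∩ Φ| = |Δ|/2` for every `t`; PRIMITIVE: balanced with no nonempty proper balanced subset.  THEOREMS: for every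
configuration `c` of the four lists, every nonempty balanced `Δ` contains two distinct points whose sign vectors cancel
(a balanced 2-subset), hence every primitive balanced set has at most 2 points.  What is NOT the kernel's: the completeness
of the 54-configuration list (the two enumerations', rev-2 STATUS l.3261 and p6 l.3354).  Supporting, cited beside the
non-simple page (P7-NonSimpleRowsFermatSweep v1.2 Lemma 1″), never frozen.
-/

namespace HodgeRepro0.P6NonSimple2Power

/-- The sign vector of the point `(i, b)`: `v i` for the representative, `−v i` for its `ι`-partner. -/
def sv (v : Fin 8 → Fin 16 → ℤ) (y : Fin 8 × Bool) (t : Fin 16) : ℤ := if y.2 then -v y.1 t else v y.1 t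

/-- The sum over `Δ` of the sign vectors is the `ε`-combination of the representatives. -/
theorem sum_sv_eq (v : Fin 8 → Fin 16 → ℤ) (Δ : Finset (Fin 8 × Bool)) (t : Fin 16) :
    ∑ y ∈ Δ, sv v y t =
      ∑ i : Fin 8, ((if (i, false) ∈ Δ then (1 : ℤ) else 0) - (if (i, true) ∈ Δ then 1 else 0)) * v i t := by
  have h : ∑ y ∈ Δ, sv v y t = ∑ y : Fin 8 × Bool, if y ∈ Δ then sv v y t else 0 := by
    rw [← Finset.sum_filter]
    congr 1
    ext y
    simp
  rw [h, Fintype.sum_prod_type]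
  refine Finset.sum_congr rfl ?_
  intro i _
  rw [Fintype.sum_bool]
  by_cases h1 : (i, false) ∈ Δ <;> by_cases h2 : (i, true) ∈ Δ <;> simp [sv, h1, h2]

/-- Independence from the certificate, entrywise: if `∑_{c < m} a c * W c t = 0` for all `t` and
`∑_t W a t * N t b = [a = b] d` for `a, b < m` with `d ≠ 0`, then `a b = 0` for `b < m`. -/
theorem coeff_eq_zero (W : ℕ → Fin 16 → ℤ) (N : Fin 16 → ℕ → ℤ) (m : ℕ) (d : ℤ) (hd : d ≠ 0)
    (hWN : ∀ a ∈ Finset.range m, ∀ b ∈ Finset.range m, ∑ t : Fin 16, W a t * N t b = if a = b then d else 0)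
    (a : ℕ → ℤ) (ha : ∀ t : Fin 16, ∑ c ∈ Finset.range m, a c * W c t = 0) (b : ℕ) (hb : b ∈ Finset.range m) :
    a b = 0 := by
  have h1 : ∑ t : Fin 16, (∑ c ∈ Finset.range m, a c * W c t) * N t b = 0 := by
    simp [ha]
  have h2 : ∑ t : Fin 16, (∑ c ∈ Finset.range m, a c * W c t) * N t b = a b * d := by
    simp only [Finset.sum_mul]
    rw [Finset.sum_comm]
    calc ∑ c ∈ Finset.range m, ∑ t : Fin 16, a c * W c t * N t b
        = ∑ c ∈ Finset.range m, a c * ∑ t : Fin 16, W c t * N t b := by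
          refine Finset.sum_congr rfl ?_; intro c _; rw [Finset.mul_sum]
          refine Finset.sum_congr rfl ?_; intro t _; ring
      _ = ∑ c ∈ Finset.range m, a c * (if c = b then d else 0) := by
          refine Finset.sum_congr rfl ?_; intro c hc; rw [hWN c hc b hb]
      _ = a b * d := by
          simp only [mul_ite, mul_zero]
          rw [Finset.sum_ite_eq']
          simp [hb]
  rw [h2] at h1
  exact (mul_eq_zero.mp h1).resolve_right hd

/-- The key lemma: with the class-representative certificate, every nonempty balanced set contains a balanced 2-set. -/
theorem key (v : Fin 8 → Fin 16 → ℤ) (cl : Fin 8 → ℕ) (σ : Fin 8 → ℤ) (hσ : ∀ i, σ i = 1 ∨ σ i = -1)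
    (W : ℕ → Fin 16 → ℤ) (N : Fin 16 → ℕ → ℤ) (m : ℕ) (d : ℤ) (hd : d ≠ 0) (hcl : ∀ i, cl i < m)
    (hWN : ∀ a ∈ Finset.range m, ∀ b ∈ Finset.range m, ∑ t : Fin 16, W a t * N t b = if a = b then d else 0)
    (hv : ∀ i t, v i t = σ i * W (cl i) t)
    (Δ : Finset (Fin 8 × Bool)) (hΔ : ∀ t, ∑ y ∈ Δ, sv v y t = 0) (hne : Δ.Nonempty) :
    ∃ y ∈ Δ, ∃ z ∈ Δ, y ≠ z ∧ ∀ t, sv v y t + sv v z t = 0 := by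
  by_cases hpair : ∃ i, (i, false) ∈ Δ ∧ (i, true) ∈ Δ
  · obtain ⟨i, h1, h2⟩ := hpair
    refine ⟨(i, false), h1, (i, true), h2, by simp, ?_⟩
    intro t; simp [sv]
  have hpair' : ∀ i, (i, false) ∈ Δ → (i, true) ∉ Δ := fun i h1 h2 => hpair ⟨i, h1, h2⟩
  -- the coefficient vector
  set ε : Fin 8 → ℤ := fun i => (if (i, false) ∈ Δ then (1 : ℤ) else 0) - (if (i, true) ∈ Δ then 1 else 0) with hε
  have hε01 : ∀ i, ε i = 0 ∨ ε i = 1 ∨ ε i = -1 := by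
    intro i; simp only [hε]; split_ifs <;> simp
  -- the class sums
  set a : ℕ → ℤ := fun c => ∑ i : Fin 8, if cl i = c then ε i * σ i else 0 with ha
  have haW : ∀ t : Fin 16, ∑ c ∈ Finset.range m, a c * W c t = 0 := by
    intro t
    have h0 := hΔ t
    rw [sum_sv_eq] at h0
    simp only [ha, Finset.sum_mul]
    rw [Finset.sum_comm]
    simp only [ite_mul, zero_mul]
    calc ∑ i : Fin 8, ∑ c ∈ Finset.range m, (if cl i = c then ε i * σ i * W c t else 0)
        = ∑ i : Fin 8, ε i * v i t := by
          refine Finset.sum_congr rfl ?_; intro i _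
          rw [Finset.sum_ite_eq, if_pos (Finset.mem_range.mpr (hcl i)), hv]; ring
      _ = 0 := h0
  have ha0 : ∀ b ∈ Finset.range m, a b = 0 := fun b hb => coeff_eq_zero W N m d hd hWN a haW b hb
  -- a point of Δ and its coefficient
  obtain ⟨⟨i₀, b₀⟩, hy₀⟩ := hne
  have hεi₀ : ε i₀ = (if b₀ then -1 else 1) := by
    cases b₀
    · have h2 : (i₀, true) ∉ Δ := hpair' i₀ hy₀
      simp [hε, hy₀, h2]
    · have h1 : (i₀, false) ∉ Δ := fun h => hpair' i₀ h hy₀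
      simp [hε, hy₀, h1]
  -- the class of i₀ has another index with the opposite signed coefficient
  have hsum : ∑ i : Fin 8, (if cl i = cl i₀ then ε i * σ i else 0) = 0 := by
    have := ha0 (cl i₀) (Finset.mem_range.mpr (hcl i₀)); simpa [ha] using this
  set s : ℤ := ε i₀ * σ i₀ with hs
  have hs1 : s = 1 ∨ s = -1 := by
    rw [hs, hεi₀]; rcases hσ i₀ with h | h <;> cases b₀ <;> simp [h]
  have hss : s * s = 1 := by rcases hs1 with h | h <;> simp [h]
  have hex : ∃ j, j ≠ i₀ ∧ cl j = cl i₀ ∧ ε j * σ j = -s := by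
    by_contra hcon
    have hcon' : ∀ j, j ≠ i₀ → cl j = cl i₀ → ε j * σ j ≠ -s := fun j h1 h2 h3 => hcon ⟨j, h1, h2, h3⟩
    -- every term times s is ≥ 0, and the i₀ term times s is 1: the sum times s is ≥ 1
    have hnonneg : ∀ i, 0 ≤ s * (if cl i = cl i₀ then ε i * σ i else 0) := by
      intro i
      by_cases hcl' : cl i = cl i₀
      · rw [if_pos hcl']
        by_cases hi : i = i₀
        · subst hi; rw [← hs, hss]; norm_num
        · have hne' : ε i * σ i ≠ -s := hcon' i hi hcl'
          rcases hε01 i with h | h | h <;> rcases hσ i with h' | h' <;> rcases hs1 with h'' | h'' <;>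
            simp only [h, h', h''] at hne' ⊢ <;> first | (exfalso; apply hne'; decide) | decide
      · rw [if_neg hcl']; simp
    have hge : s * (if cl i₀ = cl i₀ then ε i₀ * σ i₀ else 0) ≤ ∑ i : Fin 8, s * (if cl i = cl i₀ then ε i * σ i else 0) :=
      Finset.single_le_sum (fun i _ => hnonneg i) (Finset.mem_univ i₀)
    rw [← Finset.mul_sum, hsum, mul_zero, if_pos rfl, ← hs, hss] at hge
    linarith
  obtain ⟨j, hji, hcj, hj⟩ := hex
  -- the point of Δ over j
  have hεj : ε j ≠ 0 := by
    intro h; rw [h, zero_mul] at hj; rcases hs1 with h' | h' <;> rw [h'] at hj <;> norm_num at hj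
  have hzmem : ∃ bj : Bool, (j, bj) ∈ Δ ∧ ε j = (if bj then -1 else 1) := by
    rcases hε01 j with h | h | h
    · exact absurd h hεj
    · refine ⟨false, ?_, by simp [h]⟩
      by_contra hnot
      have : ε j = 0 ∨ ε j = -1 := by
        simp only [hε, hnot, if_false, zero_sub]; split_ifs <;> simp
      omega
    · refine ⟨true, ?_, by simp [h]⟩
      by_contra hnot
      have : ε j = 0 ∨ ε j = 1 := by
        simp only [hε, hnot, if_false, sub_zero]; split_ifs <;> simp
      omega
  obtain ⟨bj, hzΔ, hεj'⟩ := hzmem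
  refine ⟨(i₀, b₀), hy₀, (j, bj), hzΔ, ?_, ?_⟩
  · intro h; apply hji; exact (Prod.mk.inj h).1.symm
  · intro t
    have e1 : sv v (i₀, b₀) t = ε i₀ * v i₀ t := by
      simp only [sv, hεi₀]; cases b₀ <;> simp
    have e2 : sv v (j, bj) t = ε j * v j t := by
      simp only [sv, hεj']; cases bj <;> simp
    rw [e1, e2, hv, hv, hcj]
    have : ε i₀ * (σ i₀ * W (cl i₀) t) + ε j * (σ j * W (cl i₀) t) = (ε i₀ * σ i₀ + ε j * σ j) * W (cl i₀) t := by ring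
    rw [this, hj, ← hs]; ring



/-- A balanced set is primitive if no nonempty proper subset is balanced (Definition 1.1). -/
def PrimitiveOf (v : Fin 8 → Fin 16 → ℤ) (Δ : Finset (Fin 8 × Bool)) : Prop :=
  (∀ t, ∑ y ∈ Δ, sv v y t = 0) ∧ ∀ Δ' ⊂ Δ, Δ'.Nonempty → ¬ (∀ t, ∑ y ∈ Δ', sv v y t = 0)

/-- A primitive balanced set has at most two points, given that every nonempty balanced set contains a balanced 2-set. -/
theorem card_le_two_of_primitive (v : Fin 8 → Fin 16 → ℤ)
    (hkey : ∀ Δ : Finset (Fin 8 × Bool), (∀ t, ∑ y ∈ Δ, sv v y t = 0) → Δ.Nonempty →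
      ∃ y ∈ Δ, ∃ z ∈ Δ, y ≠ z ∧ ∀ t, sv v y t + sv v z t = 0)
    (Δ : Finset (Fin 8 × Bool)) (hp : PrimitiveOf v Δ) : Δ.card ≤ 2 := by
  by_contra hcard
  have hne : Δ.Nonempty := Finset.card_pos.mp (by omega)
  obtain ⟨y, hy, z, hz, hyz, hsum⟩ := hkey Δ hp.1 hne
  have hsub' : ({y, z} : Finset (Fin 8 × Bool)) ⊆ Δ := by
    intro w hw
    simp only [Finset.mem_insert, Finset.mem_singleton] at hw
    rcases hw with rfl | rfl <;> assumption
  have hcard2 : ({y, z} : Finset (Fin 8 × Bool)).card = 2 := Finset.card_pair_eq_two_iff.mpr hyz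
  have hsub : ({y, z} : Finset (Fin 8 × Bool)) ⊂ Δ := by
    refine Finset.ssubset_iff_subset_ne.mpr ⟨hsub', ?_⟩
    intro heq
    rw [← heq, hcard2] at hcard
    omega
  refine hp.2 {y, z} hsub ⟨y, by simp⟩ ?_
  intro t
  rw [Finset.sum_pair hyz]
  exact hsum t


/-- The sign vector of the representative `i` of `c`, from the configuration's own data: `t ↦ ±1` by `rep_b(t + r_i) ∈ Φ_b`. -/
def vrep (c : Cfg) (i : Fin 8) (t : Fin 16) : ℤ :=
  (sgn (c.Hs.getD (c.reps.getD i (0, 0)).1 []) (c.Phis.getD (c.reps.getD i (0, 0)).1 []) (c.reps.getD i (0, 0)).2).getD t 0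

/-- The sign vector of the `ι`-partner of the representative `i`, from the data: the point `(b, rep_b(ι + r_i))`. -/
def vpart (c : Cfg) (i : Fin 8) (t : Fin 16) : ℤ :=
  (sgn (c.Hs.getD (c.reps.getD i (0, 0)).1 []) (c.Phis.getD (c.reps.getD i (0, 0)).1 [])
    (rep (c.Hs.getD (c.reps.getD i (0, 0)).1 []) (tadd c.iota (c.reps.getD i (0, 0)).2))).getD t 0

/-- The class index of the representative `i`. -/
def clN (c : Cfg) (i : Fin 8) : ℕ := (c.cls.getD i (0, 0)).1

/-- The sign `σ_i` of the representative `i` relative to its class representative. -/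
def sigN (c : Cfg) (i : Fin 8) : ℤ := (c.cls.getD i (0, 0)).2

/-- The class representatives `W` as a function (rows `≥ m` are zero). -/
def WN (c : Cfg) (a : ℕ) (t : Fin 16) : ℤ := (c.W.getD a []).getD t 0

/-- The certificate `N` as a function. -/
def NN (c : Cfg) (t : Fin 16) (b : ℕ) : ℤ := (c.N.getD t []).getD b 0

/-- `Δ` is balanced: the sign vectors of its points sum to zero (Definition 1.1 in sign-vector form). -/
def Balanced (c : Cfg) (Δ : Finset (Fin 8 × Bool)) : Prop := ∀ t, ∑ y ∈ Δ, sv (vrep c) y t = 0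

/-- `Δ` is a primitive balanced set: balanced, and no nonempty proper subset is balanced (Definition 1.1). -/
def Primitive (c : Cfg) (Δ : Finset (Fin 8 × Bool)) : Prop := Balanced c Δ ∧ ∀ Δ' ⊂ Δ, Δ'.Nonempty → ¬ Balanced c Δ'

/-- The decidable hypotheses of `key` for a configuration: `σ_i = ±1`, `d ≠ 0`, the class indices below `m = |W|`,
`W · N = d · I` on `m × m`, and `v_i = σ_i · w_{c(i)}` from the configuration's own sign vectors. -/
abbrev Hyp (c : Cfg) : Prop :=
  (∀ i, sigN c i = 1 ∨ sigN c i = -1) ∧ c.d ≠ 0 ∧ (∀ i, clN c i < c.W.length) ∧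
  (∀ a ∈ Finset.range c.W.length, ∀ b ∈ Finset.range c.W.length,
      ∑ t : Fin 16, WN c a t * NN c t b = if a = b then c.d else 0) ∧
  (∀ i t, vrep c i t = sigN c i * WN c (clN c i) t)

/-- The consequence for one configuration satisfying `Hyp`: every nonempty balanced set contains a balanced 2-set. -/
theorem no_primitive_of_hyp (c : Cfg) (h : Hyp c) (Δ : Finset (Fin 8 × Bool)) (hΔ : Balanced c Δ) (hne : Δ.Nonempty) :
    ∃ y ∈ Δ, ∃ z ∈ Δ, y ≠ z ∧ ∀ t, sv (vrep c) y t + sv (vrep c) z t = 0 :=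
  key (vrep c) (clN c) (sigN c) h.1 (WN c) (NN c) c.W.length c.d h.2.1 h.2.2.1 h.2.2.2.1 h.2.2.2.2 Δ hΔ hne

/-- For one configuration satisfying `Hyp`: a primitive balanced set has at most two points. -/
theorem primitive_card_le_two_of_hyp (c : Cfg) (h : Hyp c) (Δ : Finset (Fin 8 × Bool)) (hp : Primitive c Δ) :
    Δ.card ≤ 2 :=
  card_le_two_of_primitive (vrep c) (fun Δ hΔ hne => no_primitive_of_hyp c h Δ hΔ hne) Δ hp

/-- `Hyp` holds on every configuration of `c44` (kernel-checked). -/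
theorem c44_hyp : c44.all (fun c => decide (Hyp c)) = true := by decide

/-- On every configuration of `c44` the `ι`-partner's own sign vector is the negative of the representative's. -/
theorem c44_partner : c44.all (fun c => decide (∀ i t, vpart c i t = -vrep c i t)) = true := by decide

/-- Every nonempty balanced set of every configuration of `c44` contains a balanced 2-set. -/
theorem c44_no_primitive : ∀ c ∈ c44, ∀ Δ : Finset (Fin 8 × Bool), Balanced c Δ → Δ.Nonempty →
    ∃ y ∈ Δ, ∃ z ∈ Δ, y ≠ z ∧ ∀ t, sv (vrep c) y t + sv (vrep c) z t = 0 :=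
  fun c hc => no_primitive_of_hyp c (of_decide_eq_true (List.all_eq_true.mp c44_hyp c hc))

/-- Every primitive balanced set of every configuration of `c44` has at most two points: no primitive balanced `2p`-set
with `p ≥ 2`. -/
theorem c44_primitive_card_le_two : ∀ c ∈ c44, ∀ Δ : Finset (Fin 8 × Bool), Primitive c Δ → Δ.card ≤ 2 :=
  fun c hc => primitive_card_le_two_of_hyp c (of_decide_eq_true (List.all_eq_true.mp c44_hyp c hc))

/-- `Hyp` holds on every configuration of `c422` (kernel-checked). -/
theorem c422_hyp : c422.all (fun c => decide (Hyp c)) = true := by decide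

/-- On every configuration of `c422` the `ι`-partner's own sign vector is the negative of the representative's. -/
theorem c422_partner : c422.all (fun c => decide (∀ i t, vpart c i t = -vrep c i t)) = true := by decide

/-- Every nonempty balanced set of every configuration of `c422` contains a balanced 2-set. -/
theorem c422_no_primitive : ∀ c ∈ c422, ∀ Δ : Finset (Fin 8 × Bool), Balanced c Δ → Δ.Nonempty →
    ∃ y ∈ Δ, ∃ z ∈ Δ, y ≠ z ∧ ∀ t, sv (vrep c) y t + sv (vrep c) z t = 0 :=
  fun c hc => no_primitive_of_hyp c (of_decide_eq_true (List.all_eq_true.mp c422_hyp c hc))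

/-- Every primitive balanced set of every configuration of `c422` has at most two points: no primitive balanced `2p`-set
with `p ≥ 2`. -/
theorem c422_primitive_card_le_two : ∀ c ∈ c422, ∀ Δ : Finset (Fin 8 × Bool), Primitive c Δ → Δ.card ≤ 2 :=
  fun c hc => primitive_card_le_two_of_hyp c (of_decide_eq_true (List.all_eq_true.mp c422_hyp c hc))

/-- `Hyp` holds on every configuration of `c4211` (kernel-checked). -/
theorem c4211_hyp : c4211.all (fun c => decide (Hyp c)) = true := by decide

/-- On every configuration of `c4211` the `ι`-partner's own sign vector is the negative of the representative's. -/
theorem c4211_partner : c4211.all (fun c => decide (∀ i t, vpart c i t = -vrep c i t)) = true := by decide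

/-- Every nonempty balanced set of every configuration of `c4211` contains a balanced 2-set. -/
theorem c4211_no_primitive : ∀ c ∈ c4211, ∀ Δ : Finset (Fin 8 × Bool), Balanced c Δ → Δ.Nonempty →
    ∃ y ∈ Δ, ∃ z ∈ Δ, y ≠ z ∧ ∀ t, sv (vrep c) y t + sv (vrep c) z t = 0 :=
  fun c hc => no_primitive_of_hyp c (of_decide_eq_true (List.all_eq_true.mp c4211_hyp c hc))

/-- Every primitive balanced set of every configuration of `c4211` has at most two points: no primitive balanced `2p`-set
with `p ≥ 2`. -/
theorem c4211_primitive_card_le_two : ∀ c ∈ c4211, ∀ Δ : Finset (Fin 8 × Bool), Primitive c Δ → Δ.card ≤ 2 :=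
  fun c hc => primitive_card_le_two_of_hyp c (of_decide_eq_true (List.all_eq_true.mp c4211_hyp c hc))

/-- `Hyp` holds on every configuration of `c41111` (kernel-checked). -/
theorem c41111_hyp : c41111.all (fun c => decide (Hyp c)) = true := by decide

/-- On every configuration of `c41111` the `ι`-partner's own sign vector is the negative of the representative's. -/
theorem c41111_partner : c41111.all (fun c => decide (∀ i t, vpart c i t = -vrep c i t)) = true := by decide

/-- Every nonempty balanced set of every configuration of `c41111` contains a balanced 2-set. -/
theorem c41111_no_primitive : ∀ c ∈ c41111, ∀ Δ : Finset (Fin 8 × Bool), Balanced c Δ → Δ.Nonempty →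
    ∃ y ∈ Δ, ∃ z ∈ Δ, y ≠ z ∧ ∀ t, sv (vrep c) y t + sv (vrep c) z t = 0 :=
  fun c hc => no_primitive_of_hyp c (of_decide_eq_true (List.all_eq_true.mp c41111_hyp c hc))

/-- Every primitive balanced set of every configuration of `c41111` has at most two points: no primitive balanced `2p`-set
with `p ≥ 2`. -/
theorem c41111_primitive_card_le_two : ∀ c ∈ c41111, ∀ Δ : Finset (Fin 8 × Bool), Primitive c Δ → Δ.card ≤ 2 :=
  fun c hc => primitive_card_le_two_of_hyp c (of_decide_eq_true (List.all_eq_true.mp c41111_hyp c hc))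

end HodgeRepro0.P6NonSimple2Power
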